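import Summits.BirchSwinnertonDyer.BirchSwinnertonDyer.Theorems.BiquadraticEisensteinDescentHeegnerTwistCouplingInSupplyLinnikCensusKOneThree
import Summits.BirchSwinnertonDyer.BirchSwinnertonDyer.Theorems.BiquadraticEisensteinDescentHeegnerTwistCouplingInSupplyLinnikCensusKOneInstances
import HarnessLib

set_option linter.dupNamespace false -- `Summit.BirchSwinnertonDyer.BirchSwinnertonDyer.Theorems.…` (summit = sub)
set_option autoImplicit false

/-!
# Crux `HeegnerTwistCouplingInSupply` (stmt-BirchSwinnertonDyer-21381) — the k = 1 pattern-free census for EVERY odd prime `r`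
# (slot classes supplied by CRT: no per-`r` arithmetic left)

Route `BiquadraticEisensteinDescent` (cell `pub/bsd-wall`, width seat `bsd-wall-cm-bed-w3` g19; `--supports` 21381, helper).
`…LinnikCensusKOne` / `…KOneThree` take the slot classes `kᵢ (mod 8r)` as hypotheses (discharged by `norm_num` in the instances). With
`…LinnikCensusSlot.exists_slotClass` (CRT with a residue / non-residue mod `r`) those hypotheses are dischargeable for EVERY odd prime `r`,
so the census holds with ONLY the configuration data as input:

* ★ `heegnerTwistCouplingInSupply_E3p_allBut_of_BT` / `…_E10p_…` — the BODY of the route decl `HeegnerTwistCouplingInSupply` (all binders,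
  idle hypotheses) on `W = E_{3p}` (all but `O(log⁸ Q)` primes `p ≡ 7 (mod 8)`) and `W = E_{10p}` (all but `O(log⁸ Q)` primes `p ≡ 3 (mod 4)`),
  from `…KOneInstances`;
* ★★ `kOne_allBut_three_anyR_of_BT` / `kOne_allBut_three_even_anyR_of_BT` (the two-slot twins `kOne_allBut_two(_even)_anyR_of_BT` are
  appended to `…LinnikCensusKOne`):
  for a configuration `(pc, rc, rp)`, a pattern-free family (cells, signs, `hwin` — decidable, see the table of 16 families in
  `Cruxes/HeegnerTwistCouplingInSupply/LINNIK-CENSUS-KERNEL-w3g19.md` §5) and ANY prime `r ≡ clsVal rc (mod 8)`: modulo Burungale–Tian,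
  `∃ C > 0, ∀ Q ≥ 3, ∃ E, #E ≤ C (log Q)⁸`, and every prime `p ≡ clsVal pc (mod 8)` with `[(r/p) = −1] = rp`, `⌊√Q⌋ < p ≤ Q`, `p ∉ E`
  satisfies the conclusion of crux 21381 for `W = E_{pr}` (resp. `E_{2pr}`).

Since the 16 families cover every root-number `−1` configuration, this gives: for EVERY odd prime `r` and every CM-inert class of `p`
making `E_{pr}` / `E_{2pr}` of root number `−1`, the crux conclusion holds for all but `O_r(log⁸ Q)` such primes `p ≤ Q`, modulo BT only.
HONEST FRAMING: rung-level, per fixed `r` (no uniformity in `r`); congruent two-parameter families; the crux as stated (all CM `W`; C⁺), its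
stubs and BSD are NOT touched; nothing is closed. THEOREMS ONLY.
-/

namespace Summit.BirchSwinnertonDyer.BirchSwinnertonDyer.Theorems.LinnikCensus

open Finset
open Literature.NumberTheory.EllipticCurves
open Summit.BirchSwinnertonDyer.BirchSwinnertonDyer.Theorems.SymbolicMonsky

open scoped Classical in
/-- ★★ **k = 1 census, three slots, odd base, ANY prime `r` of the class.** [cite: BurungaleTian2026, Thm. 1.1] [cite: Montgomery1978, p. 561]
[cite: MontgomeryVaughan2007, Cor. 11.17] -/
theorem kOne_allBut_three_anyR_of_BT (hBT : burungaleTian_analyticRank_eq_zero_of_selmerCorank_eq_zero_of_hasCM)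
    {pc rc : Fin 4} {rp : Bool} (c0 c1 c2 : Fin 4 × Bool) (s0 s1 s2 : Bool) (h01 : c0 ≠ c1) (h02 : c0 ≠ c2) (h12 : c1 ≠ c2)
    (hwin : ∀ b01 b02 b12 : Bool,
      (⟨[c0, c1, c2], [s0, s1, s2], [[b01, b02], [b12]]⟩ : Recipe).winsPR pc rc rp = true)
    {r : ℕ} (hr : r.Prime) (hrm : r % 8 = clsVal rc) :
    ∃ C : ℝ, 0 < C ∧ ∀ Q : ℕ, 3 ≤ Q → ∃ E : Finset ℕ, (E.card : ℝ) ≤ C * Real.log Q ^ 8 ∧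
      ∀ p : ℕ, p.Prime → p % 8 = clsVal pc → (jacobiSym (r : ℤ) p = -1 ↔ rp = true) →
        Nat.sqrt Q < p → p ≤ Q → p ∉ E →
        ∃ (K : Type) (_ : Field K) (_ : NumberField K),
          IsImaginaryQuadratic K ∧ 4 < (NumberField.discr K).natAbs ∧
          SatisfiesHeegnerHypothesis ((congruentNumberCurve (p * r)).conductorNorm ℤ) K ∧
          ((congruentNumberCurve (p * r)).quadraticTwist (NumberField.discr K : ℚ)).entireLFunction 1 ≠ 0 ∧
          ¬ p ∣ NumberField.classNumber K := by
  have hr2 := ne_two_of_mod_eight hrm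
  obtain ⟨k0, hk0u, hk0m, hk0e⟩ := exists_slotClass_cell hr hr2 c0
  obtain ⟨k1, hk1u, hk1m, hk1e⟩ := exists_slotClass_cell hr hr2 c1
  obtain ⟨k2, hk2u, hk2m, hk2e⟩ := exists_slotClass_cell hr hr2 c2
  exact kOne_allBut_three_of_BT hBT c0 c1 c2 s0 s1 s2 h01 h02 h12 hwin hr hrm k0 k1 k2 hk0u hk1u hk2u hk0m hk1m hk2m
    hk0e hk1e hk2e

open scoped Classical in
/-- ★★ **k = 1 census, three slots, even base, ANY prime `r` of the class.** [cite: BurungaleTian2026, Thm. 1.1]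
[cite: Montgomery1978, p. 561] [cite: MontgomeryVaughan2007, Cor. 11.17] -/
theorem kOne_allBut_three_even_anyR_of_BT (hBT : burungaleTian_analyticRank_eq_zero_of_selmerCorank_eq_zero_of_hasCM)
    {pc rc : Fin 4} {rp : Bool} (c0 c1 c2 : Fin 4 × Bool) (s0 s1 s2 : Bool) (h01 : c0 ≠ c1) (h02 : c0 ≠ c2) (h12 : c1 ≠ c2)
    (hwin : ∀ b01 b02 b12 : Bool,
      (⟨[c0, c1, c2], [s0, s1, s2], [[b01, b02], [b12]]⟩ : Recipe).wins2PR pc rc rp = true)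
    {r : ℕ} (hr : r.Prime) (hrm : r % 8 = clsVal rc) :
    ∃ C : ℝ, 0 < C ∧ ∀ Q : ℕ, 3 ≤ Q → ∃ E : Finset ℕ, (E.card : ℝ) ≤ C * Real.log Q ^ 8 ∧
      ∀ p : ℕ, p.Prime → p % 8 = clsVal pc → (jacobiSym (r : ℤ) p = -1 ↔ rp = true) →
        Nat.sqrt Q < p → p ≤ Q → p ∉ E →
        ∃ (K : Type) (_ : Field K) (_ : NumberField K),
          IsImaginaryQuadratic K ∧ 4 < (NumberField.discr K).natAbs ∧
          SatisfiesHeegnerHypothesis ((congruentNumberCurve (2 * (p * r))).conductorNorm ℤ) K ∧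
          ((congruentNumberCurve (2 * (p * r))).quadraticTwist (NumberField.discr K : ℚ)).entireLFunction 1 ≠ 0 ∧
          ¬ p ∣ NumberField.classNumber K := by
  have hr2 := ne_two_of_mod_eight hrm
  obtain ⟨k0, hk0u, hk0m, hk0e⟩ := exists_slotClass_cell hr hr2 c0
  obtain ⟨k1, hk1u, hk1m, hk1e⟩ := exists_slotClass_cell hr hr2 c1
  obtain ⟨k2, hk2u, hk2m, hk2e⟩ := exists_slotClass_cell hr hr2 c2
  exact kOne_allBut_three_even_of_BT hBT c0 c1 c2 s0 s1 s2 h01 h02 h12 hwin hr hrm k0 k1 k2 hk0u hk1u hk2u hk0m hk1m hk2m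
    hk0e hk1e hk2e

/-! ## The crux BODY, by the route's vocabulary, on `W = E_{3p}` off the exceptional set -/

open Literature.NumberTheory.EllipticCurves.Rank1Residual in
open scoped Classical in
/-- ★ **The BODY of `HeegnerTwistCouplingInSupply` on the family `W = E_{3p}` for all but `O(log⁸ Q)` primes `p ≡ 7 (mod 8)`, modulo
Burungale–Tian only**: `∃ C > 0, ∀ Q ≥ 3, ∃ E, #E ≤ C (log Q)⁸`, and for every `W = E_{3p}` with `p ≡ 7 (mod 8)` prime, `⌊√Q⌋ < p ≤ Q`,
`p ∉ E`, the implication of the route decl (all its binders and hypotheses — `HasCM`, `r_an = 1`, `5 ≤ p`, `CMInert`, `¬ Good`, the `∀B`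
supply — which are IDLE here) holds. The crux itself (ALL CM `W`) is NOT closed; BSD is not proved. [cite: BurungaleTian2026, Thm. 1.1] -/
theorem heegnerTwistCouplingInSupply_E3p_allBut_of_BT
    (hBT : burungaleTian_analyticRank_eq_zero_of_selmerCorank_eq_zero_of_hasCM) :
    ∃ C : ℝ, 0 < C ∧ ∀ Q : ℕ, 3 ≤ Q → ∃ E : Finset ℕ, (E.card : ℝ) ≤ C * Real.log Q ^ 8 ∧
      ∀ (W : WeierstrassCurve ℚ) [W.IsElliptic] [W.IsGloballyMinimal] (p : ℕ) [Fact p.Prime] [NeZero (W.conductorNorm ℤ)],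
        W = congruentNumberCurve (3 * p) → p % 8 = 7 → Nat.sqrt Q < p → p ≤ Q → p ∉ E →
        W.HasCM → W.analyticRank = 1 → 5 ≤ p → CMInert W p → ¬ Good W p →
        (∀ B : ℕ, ∃ (K : Type) (_ : Field K) (_ : NumberField K), IsImaginaryQuadratic K ∧ B < (NumberField.discr K).natAbs ∧
          4 < (NumberField.discr K).natAbs ∧ SatisfiesHeegnerHypothesis (W.conductorNorm ℤ) K ∧ ¬ p ∣ NumberField.classNumber K) →
        ∃ (K : Type) (_ : Field K) (_ : NumberField K),
          IsImaginaryQuadratic K ∧ 4 < (NumberField.discr K).natAbs ∧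
          SatisfiesHeegnerHypothesis (W.conductorNorm ℤ) K ∧
          (W.quadraticTwist (NumberField.discr K : ℚ)).entireLFunction 1 ≠ 0 ∧ ¬ p ∣ NumberField.classNumber K := by
  obtain ⟨C, hC, h⟩ := cruxConclusion_E3p_allBut_of_BT hBT
  refine ⟨C, hC, fun Q hQ => ?_⟩
  obtain ⟨E, hE, hp⟩ := h Q hQ
  refine ⟨E, hE, ?_⟩
  intro W _ _ p hpF _ hW hp8 hyp hpQ hpE _ _ _ _ _ _
  subst hW
  exact hp p hpF.out hp8 hyp hpQ hpE

open Literature.NumberTheory.EllipticCurves.Rank1Residual in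
open scoped Classical in
/-- ★ **The BODY of `HeegnerTwistCouplingInSupply` on the family `W = E_{10p}` for all but `O(log⁸ Q)` primes `p ≡ 3 (mod 4)`** — the whole
CM-inert class of this family — modulo Burungale–Tian only (from `…KOneInstances.cruxConclusion_E10p_allBut_of_BT`; the route decl's
hypotheses are idle). The crux itself (ALL CM `W`) is NOT closed; BSD is not proved. [cite: BurungaleTian2026, Thm. 1.1] -/
theorem heegnerTwistCouplingInSupply_E10p_allBut_of_BT
    (hBT : burungaleTian_analyticRank_eq_zero_of_selmerCorank_eq_zero_of_hasCM) :
    ∃ C : ℝ, 0 < C ∧ ∀ Q : ℕ, 3 ≤ Q → ∃ E : Finset ℕ, (E.card : ℝ) ≤ C * Real.log Q ^ 8 ∧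
      ∀ (W : WeierstrassCurve ℚ) [W.IsElliptic] [W.IsGloballyMinimal] (p : ℕ) [Fact p.Prime] [NeZero (W.conductorNorm ℤ)],
        W = congruentNumberCurve (10 * p) → p % 4 = 3 → Nat.sqrt Q < p → p ≤ Q → p ∉ E →
        W.HasCM → W.analyticRank = 1 → 5 ≤ p → CMInert W p → ¬ Good W p →
        (∀ B : ℕ, ∃ (K : Type) (_ : Field K) (_ : NumberField K), IsImaginaryQuadratic K ∧ B < (NumberField.discr K).natAbs ∧
          4 < (NumberField.discr K).natAbs ∧ SatisfiesHeegnerHypothesis (W.conductorNorm ℤ) K ∧ ¬ p ∣ NumberField.classNumber K) →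
        ∃ (K : Type) (_ : Field K) (_ : NumberField K),
          IsImaginaryQuadratic K ∧ 4 < (NumberField.discr K).natAbs ∧
          SatisfiesHeegnerHypothesis (W.conductorNorm ℤ) K ∧
          (W.quadraticTwist (NumberField.discr K : ℚ)).entireLFunction 1 ≠ 0 ∧ ¬ p ∣ NumberField.classNumber K := by
  obtain ⟨C, hC, h⟩ := cruxConclusion_E10p_allBut_of_BT hBT
  refine ⟨C, hC, fun Q hQ => ?_⟩
  obtain ⟨E, hE, hp⟩ := h Q hQ
  refine ⟨E, hE, ?_⟩
  intro W _ _ p hpF _ hW hp4 hyp hpQ hpE _ _ _ _ _ _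
  subst hW
  exact hp p hpF.out hp4 hyp hpQ hpE

end Summit.BirchSwinnertonDyer.BirchSwinnertonDyer.Theorems.LinnikCensus
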